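import Mathlib.Data.Nat.Choose.Basic
import Mathlib.Data.Nat.Choose.Central
import Mathlib.Data.Nat.Factorial.Basic
import Mathlib.Algebra.BigOperators.Intervals
import Mathlib.Algebra.Order.BigOperators.Group.Finset
import Mathlib.Tactic
import Summits.CriticalPhenomena.PercolationContinuityZ3.Theorems.PercNearOneGluingNoHeavyLowerTailCoreLemma
import Summits.CriticalPhenomena.PercolationContinuityZ3.Theorems.PercNearOneGluingNoHeavyLowerTailCoreCauchy
import HarnessLib

/-!
# Bernstein averaging, part 2: the coefficient comparison (CORE LEMMA ⟹ CORE CLAIM coefficientwise)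

Support file for the Sahi / Conjecture-P programme of route `PercNearOneGluingNoHeavy`
(`--supports stmt-CriticalPhenomena-4575`, prover prim-l12-p5 gen 27; proof notes
`prim-l12-p5/CORE-g26.md` §3.1, §5.6 and `prim-l12-p5/PROOF-DF1-g26.md` §2).  No definitions, no
named facts, no sorries.

With `f_{αγ}(j,l) = C(α,j)C(γ,l)(s+j+l)^{(α+γ-j-l)}` (the coefficients of `T_s(α,γ)`), the coefficient of
`λ^{h₁}μ^{h₂}` in `T(a+1,c+1)T(a,c)` resp. `T(a+1,c)T(a,c+1)` is
`c₁ = ∑ f_{a+1,c+1}(i₁,i₂) f_{a,c}(h₁-i₁,h₂-i₂)` resp. `c₂ = ∑ f_{a+1,c}(i₁,i₂) f_{a,c+1}(h₁-i₁,h₂-i₂)`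
(`CoreCauchy.cauchy₂`).  This file proves `c₂ ≤ c₁` (`coeff_ineq`):
* `term₁₁`, `term₁₀` : after multiplication by `K₀ = C(2a+1,a+1)C(2c+1,c+1)(h+2s-2)!` each term of
  `c₁` (`c₂`) is `C(2a+1,h₁)C(2c+1,h₂)(s+n+1)!(s+n-1)!` (`…(s+n)!²`) times the corresponding term of the
  fixed-hit-set sum `S(a+1,c+1)` (`S(a+1,c)`) of the CORE LEMMA (subset-of-a-subset identity and the
  buffer identities of `CoreCauchy`);
* `coeff_ineq` : for `h₁, h₂ ≥ 1` this and `CoreLemma.core_lemma` give `c₂ ≤ c₁`; for `h₂ = 0` or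
  `h₁ = 0` the comparison is termwise (`CoreCauchy.asc_step`, after a reflection when `h₁ = 0`).
-/

namespace Summit.CriticalPhenomena.PercolationContinuityZ3.Theorems

namespace CoreClaim

open Finset

/-- Termwise form of `K₀·c₁`: the `(i₁,i₂)` term of the coefficient of `T(a+1,c+1)T(a,c)` against the
`(i₁,i₂)` term of `S(a+1,c+1)`. -/
theorem term₁₁ (a c s h₁ h₂ i₁ i₂ : ℕ) (hsn : 1 ≤ s + (a + c)) (hh₁ : 1 ≤ h₁) (hh₂ : 1 ≤ h₂)
    (hh₁' : h₁ ≤ 2 * a + 1) (hh₂' : h₂ ≤ 2 * c + 1) (hi₁ : i₁ ≤ h₁) (hi₂ : i₂ ≤ h₂) :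
    (((2 * a + 1).choose (a + 1) * (2 * c + 1).choose (c + 1) * (h₁ + h₂ + 2 * s - 2).factorial : ℕ) : ℝ) *
      (if (i₁ ≤ a + 1 ∧ h₁ - i₁ ≤ a) ∧ (i₂ ≤ c + 1 ∧ h₂ - i₂ ≤ c) then
        ((a + 1).choose i₁ : ℝ) * ((c + 1).choose i₂ : ℝ) *
            ((s + (i₁ + i₂)).ascFactorial (a + 1 + (c + 1) - (i₁ + i₂)) : ℝ) *
          ((a.choose (h₁ - i₁) : ℝ) * (c.choose (h₂ - i₂) : ℝ) *
            ((s + (h₁ - i₁ + (h₂ - i₂))).ascFactorial (a + c - (h₁ - i₁ + (h₂ - i₂))) : ℝ))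
        else 0) =
    (((2 * a + 1).choose h₁ * (2 * c + 1).choose h₂ *
        ((s + (a + c) + 1).factorial * (s + (a + c) - 1).factorial) : ℕ) : ℝ) *
      ((h₁.choose i₁ : ℝ) * (if i₁ ≤ a + 1 then ((2 * a + 1 - h₁).choose (a + 1 - i₁) : ℝ) else 0) *
        ((h₂.choose i₂ : ℝ) * (if i₂ ≤ c + 1 then ((2 * c + 1 - h₂).choose (c + 1 - i₂) : ℝ) else 0)) *
        (if 1 ≤ i₁ + i₂ + s then ((h₁ + h₂ + 2 * s - 2).choose (i₁ + i₂ + s - 1) : ℝ) else 0)) := by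
  by_cases hP : (i₁ ≤ a + 1 ∧ h₁ - i₁ ≤ a) ∧ (i₂ ≤ c + 1 ∧ h₂ - i₂ ≤ c)
  · rw [if_pos hP, if_pos hP.1.1, if_pos hP.2.1]
    have E₁ := CoreCauchy.choose_choose_choose (2 * a + 1) (a + 1) i₁ (h₁ - i₁) hP.1.1 (by omega)
      (by omega)
    rw [show 2 * a + 1 - (a + 1) = a by omega, show i₁ + (h₁ - i₁) = h₁ by omega] at E₁
    have E₂ := CoreCauchy.choose_choose_choose (2 * c + 1) (c + 1) i₂ (h₂ - i₂) hP.2.1 (by omega)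
      (by omega)
    rw [show 2 * c + 1 - (c + 1) = c by omega, show i₂ + (h₂ - i₂) = h₂ by omega] at E₂
    have E₃ := CoreCauchy.buffer_fact₁ s (a + c) (i₁ + i₂) (h₁ - i₁ + (h₂ - i₂)) hsn (by omega)
      (by omega) (by omega)
    rw [show i₁ + i₂ + (h₁ - i₁ + (h₂ - i₂)) + 2 * s - 2 = h₁ + h₂ + 2 * s - 2 by omega,
      show a + c + 2 - (i₁ + i₂) = a + 1 + (c + 1) - (i₁ + i₂) by omega] at E₃
    have E₁r : (((2 * a + 1).choose (a + 1) : ℕ) : ℝ) * (((a + 1).choose i₁ : ℝ) * (a.choose (h₁ - i₁) : ℝ)) =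
        ((2 * a + 1).choose h₁ : ℝ) * ((h₁.choose i₁ : ℝ) * ((2 * a + 1 - h₁).choose (a + 1 - i₁) : ℝ)) := by
      exact_mod_cast E₁
    have E₂r : (((2 * c + 1).choose (c + 1) : ℕ) : ℝ) * (((c + 1).choose i₂ : ℝ) * (c.choose (h₂ - i₂) : ℝ)) =
        ((2 * c + 1).choose h₂ : ℝ) * ((h₂.choose i₂ : ℝ) * ((2 * c + 1 - h₂).choose (c + 1 - i₂) : ℝ)) := by
      exact_mod_cast E₂
    have E₃r : ((h₁ + h₂ + 2 * s - 2).factorial : ℝ) *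
        (((s + (i₁ + i₂)).ascFactorial (a + 1 + (c + 1) - (i₁ + i₂)) : ℝ) *
          ((s + (h₁ - i₁ + (h₂ - i₂))).ascFactorial (a + c - (h₁ - i₁ + (h₂ - i₂))) : ℝ)) =
        ((s + (a + c) + 1).factorial : ℝ) * ((s + (a + c) - 1).factorial : ℝ) *
          (if 1 ≤ i₁ + i₂ + s then ((h₁ + h₂ + 2 * s - 2).choose (i₁ + i₂ + s - 1) : ℝ) else 0) := by
      have h := E₃
      apply_fun (fun m : ℕ => (m : ℝ)) at h
      push_cast at h
      exact h
    push_cast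
    linear_combination (((2 * c + 1).choose (c + 1) : ℝ) * (((c + 1).choose i₂ : ℝ) * (c.choose (h₂ - i₂) : ℝ)) *
        (((h₁ + h₂ + 2 * s - 2).factorial : ℝ) *
        (((s + (i₁ + i₂)).ascFactorial (a + 1 + (c + 1) - (i₁ + i₂)) : ℝ) *
          ((s + (h₁ - i₁ + (h₂ - i₂))).ascFactorial (a + c - (h₁ - i₁ + (h₂ - i₂))) : ℝ)))) * E₁r +
      (((2 * a + 1).choose h₁ : ℝ) * ((h₁.choose i₁ : ℝ) * ((2 * a + 1 - h₁).choose (a + 1 - i₁) : ℝ)) *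
        (((h₁ + h₂ + 2 * s - 2).factorial : ℝ) *
        (((s + (i₁ + i₂)).ascFactorial (a + 1 + (c + 1) - (i₁ + i₂)) : ℝ) *
          ((s + (h₁ - i₁ + (h₂ - i₂))).ascFactorial (a + c - (h₁ - i₁ + (h₂ - i₂))) : ℝ)))) * E₂r +
      (((2 * a + 1).choose h₁ : ℝ) * ((h₁.choose i₁ : ℝ) * ((2 * a + 1 - h₁).choose (a + 1 - i₁) : ℝ)) *
        (((2 * c + 1).choose h₂ : ℝ) * ((h₂.choose i₂ : ℝ) * ((2 * c + 1 - h₂).choose (c + 1 - i₂) : ℝ)))) * E₃r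
  · -- the corresponding `S(a+1,c+1)` term vanishes as well
    rw [if_neg hP, mul_zero]
    symm
    by_cases h1 : i₁ ≤ a + 1
    · by_cases h2 : i₂ ≤ c + 1
      · rw [if_pos h1, if_pos h2]
        have : a < h₁ - i₁ ∨ c < h₂ - i₂ := by
          by_contra hc
          push Not at hc
          exact hP ⟨⟨h1, hc.1⟩, ⟨h2, hc.2⟩⟩
        rcases this with h3 | h3
        · rw [Nat.choose_eq_zero_of_lt (show 2 * a + 1 - h₁ < a + 1 - i₁ by omega)]
          simp
        · rw [Nat.choose_eq_zero_of_lt (show 2 * c + 1 - h₂ < c + 1 - i₂ by omega)]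
          simp
      · rw [if_neg h2]
        simp
    · rw [if_neg h1]
      simp

/-- Termwise form of `K₀·c₂`: the `(i₁,i₂)` term of the coefficient of `T(a+1,c)T(a,c+1)` against the
`(i₁,i₂)` term of `S(a+1,c)`. -/
theorem term₁₀ (a c s h₁ h₂ i₁ i₂ : ℕ) (hh₁ : 1 ≤ h₁) (hh₂ : 1 ≤ h₂)
    (hh₁' : h₁ ≤ 2 * a + 1) (hh₂' : h₂ ≤ 2 * c + 1) (hi₁ : i₁ ≤ h₁) (hi₂ : i₂ ≤ h₂) :
    (((2 * a + 1).choose (a + 1) * (2 * c + 1).choose (c + 1) * (h₁ + h₂ + 2 * s - 2).factorial : ℕ) : ℝ) *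
      (if (i₁ ≤ a + 1 ∧ h₁ - i₁ ≤ a) ∧ (i₂ ≤ c ∧ h₂ - i₂ ≤ c + 1) then
        ((a + 1).choose i₁ : ℝ) * (c.choose i₂ : ℝ) *
            ((s + (i₁ + i₂)).ascFactorial (a + 1 + c - (i₁ + i₂)) : ℝ) *
          ((a.choose (h₁ - i₁) : ℝ) * ((c + 1).choose (h₂ - i₂) : ℝ) *
            ((s + (h₁ - i₁ + (h₂ - i₂))).ascFactorial (a + (c + 1) - (h₁ - i₁ + (h₂ - i₂))) : ℝ))
        else 0) =
    (((2 * a + 1).choose h₁ * (2 * c + 1).choose h₂ *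
        ((s + (a + c)).factorial * (s + (a + c)).factorial) : ℕ) : ℝ) *
      ((h₁.choose i₁ : ℝ) * (if i₁ ≤ a + 1 then ((2 * a + 1 - h₁).choose (a + 1 - i₁) : ℝ) else 0) *
        ((h₂.choose i₂ : ℝ) * (if i₂ ≤ c then ((2 * c + 1 - h₂).choose (c - i₂) : ℝ) else 0)) *
        (if 1 ≤ i₁ + i₂ + s then ((h₁ + h₂ + 2 * s - 2).choose (i₁ + i₂ + s - 1) : ℝ) else 0)) := by
  by_cases hP : (i₁ ≤ a + 1 ∧ h₁ - i₁ ≤ a) ∧ (i₂ ≤ c ∧ h₂ - i₂ ≤ c + 1)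
  · rw [if_pos hP, if_pos hP.1.1, if_pos hP.2.1]
    have E₁ := CoreCauchy.choose_choose_choose (2 * a + 1) (a + 1) i₁ (h₁ - i₁) hP.1.1 (by omega)
      (by omega)
    rw [show 2 * a + 1 - (a + 1) = a by omega, show i₁ + (h₁ - i₁) = h₁ by omega] at E₁
    have E₂ := CoreCauchy.choose_choose_choose (2 * c + 1) c i₂ (h₂ - i₂) hP.2.1 (by omega)
      (by omega)
    rw [show 2 * c + 1 - c = c + 1 by omega, show i₂ + (h₂ - i₂) = h₂ by omega,
      ← Nat.choose_symm_half c] at E₂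
    have E₃ := CoreCauchy.buffer_fact₂ s (a + c) (i₁ + i₂) (h₁ - i₁ + (h₂ - i₂)) (by omega)
      (by omega) (by omega)
    rw [show i₁ + i₂ + (h₁ - i₁ + (h₂ - i₂)) + 2 * s - 2 = h₁ + h₂ + 2 * s - 2 by omega,
      show a + c + 1 - (i₁ + i₂) = a + 1 + c - (i₁ + i₂) by omega,
      show a + c + 1 - (h₁ - i₁ + (h₂ - i₂)) = a + (c + 1) - (h₁ - i₁ + (h₂ - i₂)) by omega] at E₃
    have E₁r : (((2 * a + 1).choose (a + 1) : ℕ) : ℝ) * (((a + 1).choose i₁ : ℝ) * (a.choose (h₁ - i₁) : ℝ)) =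
        ((2 * a + 1).choose h₁ : ℝ) * ((h₁.choose i₁ : ℝ) * ((2 * a + 1 - h₁).choose (a + 1 - i₁) : ℝ)) := by
      exact_mod_cast E₁
    have E₂r : (((2 * c + 1).choose (c + 1) : ℕ) : ℝ) * ((c.choose i₂ : ℝ) * ((c + 1).choose (h₂ - i₂) : ℝ)) =
        ((2 * c + 1).choose h₂ : ℝ) * ((h₂.choose i₂ : ℝ) * ((2 * c + 1 - h₂).choose (c - i₂) : ℝ)) := by
      exact_mod_cast E₂
    have E₃r : ((h₁ + h₂ + 2 * s - 2).factorial : ℝ) *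
        (((s + (i₁ + i₂)).ascFactorial (a + 1 + c - (i₁ + i₂)) : ℝ) *
          ((s + (h₁ - i₁ + (h₂ - i₂))).ascFactorial (a + (c + 1) - (h₁ - i₁ + (h₂ - i₂))) : ℝ)) =
        ((s + (a + c)).factorial : ℝ) * ((s + (a + c)).factorial : ℝ) *
          (if 1 ≤ i₁ + i₂ + s then ((h₁ + h₂ + 2 * s - 2).choose (i₁ + i₂ + s - 1) : ℝ) else 0) := by
      have h := E₃
      apply_fun (fun m : ℕ => (m : ℝ)) at h
      push_cast at h
      exact h
    push_cast
    linear_combination (((2 * c + 1).choose (c + 1) : ℝ) * ((c.choose i₂ : ℝ) * ((c + 1).choose (h₂ - i₂) : ℝ)) *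
        (((h₁ + h₂ + 2 * s - 2).factorial : ℝ) *
        (((s + (i₁ + i₂)).ascFactorial (a + 1 + c - (i₁ + i₂)) : ℝ) *
          ((s + (h₁ - i₁ + (h₂ - i₂))).ascFactorial (a + (c + 1) - (h₁ - i₁ + (h₂ - i₂))) : ℝ)))) * E₁r +
      (((2 * a + 1).choose h₁ : ℝ) * ((h₁.choose i₁ : ℝ) * ((2 * a + 1 - h₁).choose (a + 1 - i₁) : ℝ)) *
        (((h₁ + h₂ + 2 * s - 2).factorial : ℝ) *
        (((s + (i₁ + i₂)).ascFactorial (a + 1 + c - (i₁ + i₂)) : ℝ) *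
          ((s + (h₁ - i₁ + (h₂ - i₂))).ascFactorial (a + (c + 1) - (h₁ - i₁ + (h₂ - i₂))) : ℝ)))) * E₂r +
      (((2 * a + 1).choose h₁ : ℝ) * ((h₁.choose i₁ : ℝ) * ((2 * a + 1 - h₁).choose (a + 1 - i₁) : ℝ)) *
        (((2 * c + 1).choose h₂ : ℝ) * ((h₂.choose i₂ : ℝ) * ((2 * c + 1 - h₂).choose (c - i₂) : ℝ)))) * E₃r
  · -- the corresponding `S(a+1,c)` term vanishes as well
    rw [if_neg hP, mul_zero]
    symm
    by_cases h1 : i₁ ≤ a + 1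
    · by_cases h2 : i₂ ≤ c
      · rw [if_pos h1, if_pos h2]
        have : a < h₁ - i₁ ∨ c + 1 < h₂ - i₂ := by
          by_contra hc
          push Not at hc
          exact hP ⟨⟨h1, hc.1⟩, ⟨h2, hc.2⟩⟩
        rcases this with h3 | h3
        · rw [Nat.choose_eq_zero_of_lt (show 2 * a + 1 - h₁ < a + 1 - i₁ by omega)]
          simp
        · rw [Nat.choose_eq_zero_of_lt (show 2 * c + 1 - h₂ < c - i₂ by omega)]
          simp
      · rw [if_neg h2]
        simp
    · rw [if_neg h1]
      simp

/-- **The coefficient inequality** `c₂(h₁,h₂) ≤ c₁(h₁,h₂)` (CORE CLAIM, coefficientwise). -/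
theorem coeff_ineq (a c s h₁ h₂ : ℕ) (hsn : 1 ≤ s + (a + c)) (hh₁' : h₁ ≤ 2 * a + 1)
    (hh₂' : h₂ ≤ 2 * c + 1) :
    ∑ i₁ ∈ range (h₁ + 1), ∑ i₂ ∈ range (h₂ + 1),
      (if (i₁ ≤ a + 1 ∧ h₁ - i₁ ≤ a) ∧ (i₂ ≤ c ∧ h₂ - i₂ ≤ c + 1) then
        ((a + 1).choose i₁ : ℝ) * (c.choose i₂ : ℝ) *
            ((s + (i₁ + i₂)).ascFactorial (a + 1 + c - (i₁ + i₂)) : ℝ) *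
          ((a.choose (h₁ - i₁) : ℝ) * ((c + 1).choose (h₂ - i₂) : ℝ) *
            ((s + (h₁ - i₁ + (h₂ - i₂))).ascFactorial (a + (c + 1) - (h₁ - i₁ + (h₂ - i₂))) : ℝ))
        else 0) ≤
    ∑ i₁ ∈ range (h₁ + 1), ∑ i₂ ∈ range (h₂ + 1),
      (if (i₁ ≤ a + 1 ∧ h₁ - i₁ ≤ a) ∧ (i₂ ≤ c + 1 ∧ h₂ - i₂ ≤ c) then
        ((a + 1).choose i₁ : ℝ) * ((c + 1).choose i₂ : ℝ) *
            ((s + (i₁ + i₂)).ascFactorial (a + 1 + (c + 1) - (i₁ + i₂)) : ℝ) *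
          ((a.choose (h₁ - i₁) : ℝ) * (c.choose (h₂ - i₂) : ℝ) *
            ((s + (h₁ - i₁ + (h₂ - i₂))).ascFactorial (a + c - (h₁ - i₁ + (h₂ - i₂))) : ℝ))
        else 0) := by
  rcases Nat.eq_zero_or_pos h₂ with h20 | h2pos
  · -- no block-2 hits: termwise comparison
    subst h20
    simp only [show (0 : ℕ) + 1 = 1 from rfl, sum_range_one]
    refine sum_le_sum fun i₁ hi₁ => ?_
    have hi₁' : i₁ ≤ h₁ := by have := mem_range.mp hi₁; omega
    split_ifs with g1 g2
    · have key := CoreCauchy.asc_step s (a + c) i₁ (h₁ - i₁) (by omega) (by omega)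
      have hle : (s + i₁).ascFactorial (a + c + 1 - i₁) * (s + (h₁ - i₁)).ascFactorial (a + c + 1 - (h₁ - i₁)) ≤
          (s + i₁).ascFactorial (a + c + 2 - i₁) * (s + (h₁ - i₁)).ascFactorial (a + c - (h₁ - i₁)) := by
        exact Nat.le_of_mul_le_mul_left (by rw [key]; exact Nat.mul_le_mul_right _ (by omega))
          (show 0 < s + (a + c) by omega)
      have hler : (((s + i₁).ascFactorial (a + c + 1 - i₁) : ℕ) : ℝ) *
          (((s + (h₁ - i₁)).ascFactorial (a + c + 1 - (h₁ - i₁)) : ℕ) : ℝ) ≤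
          (((s + i₁).ascFactorial (a + c + 2 - i₁) : ℕ) : ℝ) *
          (((s + (h₁ - i₁)).ascFactorial (a + c - (h₁ - i₁)) : ℕ) : ℝ) := by exact_mod_cast hle
      simp only [add_zero, Nat.sub_zero, Nat.choose_zero_right, Nat.cast_one, mul_one]
      rw [show a + 1 + c - i₁ = a + c + 1 - i₁ by omega,
        show a + (c + 1) - (h₁ - i₁) = a + c + 1 - (h₁ - i₁) by omega,
        show a + 1 + (c + 1) - i₁ = a + c + 2 - i₁ by omega]
      have hC : (0 : ℝ) ≤ ((a + 1).choose i₁ : ℝ) * (a.choose (h₁ - i₁) : ℝ) := by positivity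
      nlinarith [mul_le_mul_of_nonneg_left hler hC]
    · exact absurd ⟨g1.1, by omega, by omega⟩ g2
    · positivity
    · exact le_rfl
  rcases Nat.eq_zero_or_pos h₁ with h10 | h1pos
  · -- no block-1 hits: reflect block 2, then termwise
    subst h10
    simp only [show (0 : ℕ) + 1 = 1 from rfl, sum_range_one]
    rw [← sum_range_reflect _ (h₂ + 1)]
    refine sum_le_sum fun j hj => ?_
    have hj' : j ≤ h₂ := by have := mem_range.mp hj; omega
    simp only [Nat.add_sub_cancel]
    rw [show h₂ - (h₂ - j) = j by omega]
    split_ifs with g1 g2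
    · have key := CoreCauchy.asc_step s (a + c) j (h₂ - j) (by omega) (by omega)
      have hle : (s + j).ascFactorial (a + c + 1 - j) * (s + (h₂ - j)).ascFactorial (a + c + 1 - (h₂ - j)) ≤
          (s + j).ascFactorial (a + c + 2 - j) * (s + (h₂ - j)).ascFactorial (a + c - (h₂ - j)) := by
        exact Nat.le_of_mul_le_mul_left (by rw [key]; exact Nat.mul_le_mul_right _ (by omega))
          (show 0 < s + (a + c) by omega)
      have hler : (((s + j).ascFactorial (a + c + 1 - j) : ℕ) : ℝ) *
          (((s + (h₂ - j)).ascFactorial (a + c + 1 - (h₂ - j)) : ℕ) : ℝ) ≤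
          (((s + j).ascFactorial (a + c + 2 - j) : ℕ) : ℝ) *
          (((s + (h₂ - j)).ascFactorial (a + c - (h₂ - j)) : ℕ) : ℝ) := by exact_mod_cast hle
      simp only [zero_add, Nat.sub_zero, Nat.choose_zero_right, Nat.cast_one, one_mul]
      rw [show a + 1 + c - (h₂ - j) = a + c + 1 - (h₂ - j) by omega,
        show a + (c + 1) - j = a + c + 1 - j by omega,
        show a + 1 + (c + 1) - j = a + c + 2 - j by omega]
      have hC : (0 : ℝ) ≤ ((c + 1).choose j : ℝ) * (c.choose (h₂ - j) : ℝ) := by positivity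
      nlinarith [mul_le_mul_of_nonneg_left hler hC]
    · exact absurd ⟨⟨by omega, by omega⟩, by omega, by omega⟩ g2
    · positivity
    · exact le_rfl
  -- both blocks hit: CORE LEMMA
  have hK : (0 : ℝ) < (((2 * a + 1).choose (a + 1) * (2 * c + 1).choose (c + 1) *
      (h₁ + h₂ + 2 * s - 2).factorial : ℕ) : ℝ) := by
    exact_mod_cast Nat.mul_pos (Nat.mul_pos (Nat.choose_pos (by omega)) (Nat.choose_pos (by omega)))
      (Nat.factorial_pos _)
  refine le_of_mul_le_mul_left ?_ hK
  rw [mul_sum, mul_sum]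
  simp_rw [mul_sum]
  rw [sum_congr rfl fun i₁ hi₁ => sum_congr rfl fun i₂ hi₂ =>
    term₁₀ a c s h₁ h₂ i₁ i₂ h1pos h2pos hh₁' hh₂'
      (by have := mem_range.mp hi₁; omega) (by have := mem_range.mp hi₂; omega)]
  rw [sum_congr rfl fun i₁ hi₁ => sum_congr rfl fun i₂ hi₂ =>
    term₁₁ a c s h₁ h₂ i₁ i₂ hsn h1pos h2pos hh₁' hh₂'
      (by have := mem_range.mp hi₁; omega) (by have := mem_range.mp hi₂; omega)]
  simp_rw [← mul_sum]
  have hcore := CoreLemma.core_lemma a c h₁ (2 * a + 1 - h₁) h₂ (2 * c + 1 - h₂) s (by omega) (by omega)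
    (by omega) (by omega)
  have hf1 : (s + (a + c)).factorial = (s + (a + c)) * (s + (a + c) - 1).factorial := by
    have := Nat.factorial_succ (s + (a + c) - 1)
    rw [show s + (a + c) - 1 + 1 = s + (a + c) by omega] at this
    exact this
  have hf2 : (s + (a + c) + 1).factorial = (s + (a + c) + 1) * (s + (a + c)).factorial :=
    Nat.factorial_succ _
  rw [hf2, hf1]
  push_cast
  have hP0 : (0 : ℝ) ≤ ((2 * a + 1).choose h₁ : ℝ) * ((2 * c + 1).choose h₂ : ℝ) *
      ((s + (a + c) - 1).factorial : ℝ) * ((s + (a + c) - 1).factorial : ℝ) * ((s : ℝ) + (a + c)) := by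
    positivity
  nlinarith [mul_le_mul_of_nonneg_left hcore hP0]

/-- **CORE CLAIM (note §2.4, §5.6; THEOREM).**  For every integer `s ≥ 0` with `s + a + c ≥ 1` and all
real `λ, μ ≥ 0`, the bivariate array `T_s(α,γ) = ∑_{j ≤ α, l ≤ γ} C(α,j)C(γ,l) λ^j μ^l (s+j+l)^{(α+γ-j-l)}`
— the density-level two-block partition function of the single-type de Finetti law with `s` sure
points, `= Γ(s+α+γ)·E[λ^J μ^L / Γ(s+J+L)]`-type Laguerre array — is TP₂ on the unit square at `(a,c)`:
`T(a+1,c)·T(a,c+1) ≤ T(a+1,c+1)·T(a,c)`.  (Bernstein averaging over one ground set with blocks of the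
odd sizes `2a+1, 2c+1` reduces each coefficient of `λ^{h₁}μ^{h₂}` to the CORE LEMMA.) -/
theorem core_claim (a c s : ℕ) (hsn : 1 ≤ s + (a + c)) (x y : ℝ) (hx : 0 ≤ x) (hy : 0 ≤ y) :
    (∑ j ∈ range (a + 1 + 1), ∑ l ∈ range (c + 1), ((a + 1).choose j : ℝ) * (c.choose l : ℝ) *
        ((s + (j + l)).ascFactorial (a + 1 + c - (j + l)) : ℝ) * (x ^ j * y ^ l)) *
      (∑ j ∈ range (a + 1), ∑ l ∈ range (c + 1 + 1), (a.choose j : ℝ) * ((c + 1).choose l : ℝ) *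
        ((s + (j + l)).ascFactorial (a + (c + 1) - (j + l)) : ℝ) * (x ^ j * y ^ l)) ≤
    (∑ j ∈ range (a + 1 + 1), ∑ l ∈ range (c + 1 + 1), ((a + 1).choose j : ℝ) * ((c + 1).choose l : ℝ) *
        ((s + (j + l)).ascFactorial (a + 1 + (c + 1) - (j + l)) : ℝ) * (x ^ j * y ^ l)) *
      (∑ j ∈ range (a + 1), ∑ l ∈ range (c + 1), (a.choose j : ℝ) * (c.choose l : ℝ) *
        ((s + (j + l)).ascFactorial (a + c - (j + l)) : ℝ) * (x ^ j * y ^ l)) := by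
  rw [CoreCauchy.cauchy₂ (fun j l => ((a + 1).choose j : ℝ) * (c.choose l : ℝ) *
      ((s + (j + l)).ascFactorial (a + 1 + c - (j + l)) : ℝ))
    (fun j l => (a.choose j : ℝ) * ((c + 1).choose l : ℝ) *
      ((s + (j + l)).ascFactorial (a + (c + 1) - (j + l)) : ℝ)),
    CoreCauchy.cauchy₂ (fun j l => ((a + 1).choose j : ℝ) * ((c + 1).choose l : ℝ) *
      ((s + (j + l)).ascFactorial (a + 1 + (c + 1) - (j + l)) : ℝ))
    (fun j l => (a.choose j : ℝ) * (c.choose l : ℝ) *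
      ((s + (j + l)).ascFactorial (a + c - (j + l)) : ℝ))]
  rw [show c + (c + 1) + 1 = c + 1 + c + 1 by ring]
  refine sum_le_sum fun h₁ hh₁ => sum_le_sum fun h₂ hh₂ => ?_
  have hh₁' : h₁ ≤ 2 * a + 1 := by have := mem_range.mp hh₁; omega
  have hh₂' : h₂ ≤ 2 * c + 1 := by have := mem_range.mp hh₂; omega
  exact mul_le_mul_of_nonneg_right (coeff_ineq a c s h₁ h₂ hsn hh₁' hh₂') (by positivity)

/-- The remaining unit square for `s = 0`: at `(a,c) = (0,0)` (excluded from `core_claim` by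
`s + a + c ≥ 1`) the inequality reads `λ·μ ≤ (λ + μ + λμ)·1` and holds as well. -/
theorem core_claim_origin (x y : ℝ) (hx : 0 ≤ x) (hy : 0 ≤ y) :
    (∑ j ∈ range (0 + 1 + 1), ∑ l ∈ range (0 + 1), ((0 + 1).choose j : ℝ) * ((0 : ℕ).choose l : ℝ) *
        ((0 + (j + l)).ascFactorial (0 + 1 + 0 - (j + l)) : ℝ) * (x ^ j * y ^ l)) *
      (∑ j ∈ range (0 + 1), ∑ l ∈ range (0 + 1 + 1), ((0 : ℕ).choose j : ℝ) * ((0 + 1).choose l : ℝ) *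
        ((0 + (j + l)).ascFactorial (0 + (0 + 1) - (j + l)) : ℝ) * (x ^ j * y ^ l)) ≤
    (∑ j ∈ range (0 + 1 + 1), ∑ l ∈ range (0 + 1 + 1), ((0 + 1).choose j : ℝ) * ((0 + 1).choose l : ℝ) *
        ((0 + (j + l)).ascFactorial (0 + 1 + (0 + 1) - (j + l)) : ℝ) * (x ^ j * y ^ l)) *
      (∑ j ∈ range (0 + 1), ∑ l ∈ range (0 + 1), ((0 : ℕ).choose j : ℝ) * ((0 : ℕ).choose l : ℝ) *
        ((0 + (j + l)).ascFactorial (0 + 0 - (j + l)) : ℝ) * (x ^ j * y ^ l)) := by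
  simp [sum_range_succ, Nat.ascFactorial]
  nlinarith [mul_nonneg hx hy]

end CoreClaim

end Summit.CriticalPhenomena.PercolationContinuityZ3.Theorems
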